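import Summits.Ventures.LatticeQCDFlow.Scoring.BesselToeplitzAndreief
import Literature.RingTheory.SymmetricFunctions.SchurPolynomials
import HarnessLib

/-!
# Parseval on the Weyl torus for integer polynomials, and the alternant `a_ρ · p_1^n` at the torus point

HONEST FRAMING: exact (Metropolis-corrected) sampling algorithms for lattice gauge theory;
figures of merit are autocorrelation/cost numbers at stated couplings and volumes; no
continuum-physics claim.

Venture `LatticeQCDFlow` (cell pub-lqcd), sub-topic `Scoring`; FANOUT row 5 (`s0-sun-a`), GEN-23.
NEW WORK of the cell (placement rule).  The analytic half of the exact even trace moments of a Haar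
unitary (`UNHaarTraceMomentsTableaux`; the algebraic half is `AlternantPowerSumCoefficients`):

* §1 **Parseval on the torus** (`integral_cube_norm_sq_eval₂`, `…_real`): for an integer polynomial `P`
  in `N` variables, `∫_{(−π,π]^N} |P(e^{iθ_1}, …, e^{iθ_N})|² dθ = (2π)^N Σ_d ([x^d] P)²` — orthogonality
  of the characters of the torus (the tree's `integral_cube_prod_cexp` of the Weyl-integration files);
* §2 at the torus point `z_b = e^{iθ_b}` the antisymmetric polynomial `a_ρ(x) · p_1(x)^n` (the Vandermonde
  alternant of the tree's `SchurPolynomials` times the `n`-th power of the first power sum) evaluates to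
  `a_ρ(z) · (Σ_b z_b)^n` with `|a_ρ(z)| = |Δ(θ)|` (the tree's `vdm`, a relabelling of the columns), so
  `|(a_ρ p_1^n)(e^{iθ})|² = |Σ_b e^{iθ_b}|^{2n} · Π_{j≺k}|e^{iθ_j} − e^{iθ_k}|²`
  (`norm_sq_eval₂_alternant_mul_psum_pow`) — exactly the angle integrand of Weyl's integration formula
  for the class function `|tr U|^{2n}` on `U(N)`.

Parents: the tree's `WeylIntegrationVandermonde` (through row 5's `BesselToeplitzAndreief`, for the
identification `Π_{j≺k}|e^{iθ_j} − e^{iθ_k}|² = |Δ(θ)|²`) and `SchurPolynomials`.  No `def`, no named fact,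
0 sorry.
-/

noncomputable section

open Real MeasureTheory Finset Complex Equiv
open scoped ENNReal ComplexConjugate
open Literature.RepresentationTheory.CompactGroups.WeylIntegration
open Literature.RingTheory.SymmetricFunctions.SymmPoly (alternant rho map_alternant)

namespace Summit.Ventures.LatticeQCDFlow.Scoring

variable {N : ℕ}

/-! ### 1. Parseval on the torus for integer polynomials -/

/-- A product of characters of the torus is integrable on the cube `(−π,π]^N`. -/
theorem integrable_cube_prod_cexp_int (m : Fin N → ℤ) :
    Integrable (fun θ : Fin N → ℝ => ∏ b, cexp (m b * θ b * I))
      (Measure.pi fun _ : Fin N => (volume : Measure ℝ).restrict (Set.Ioc (-π) π)) := by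
  refine Integrable.mono' (integrable_const (1 : ℝ)) ?_ (Filter.Eventually.of_forall fun θ => ?_)
  · exact (continuous_finsetProd _ fun b _ => by fun_prop).aestronglyMeasurable
  · rw [norm_prod]
    refine le_of_eq (Finset.prod_eq_one fun b _ => ?_)
    rw [show (m b : ℂ) * (θ b : ℂ) * I = (((m b : ℝ) * θ b : ℝ) : ℂ) * I by push_cast; ring]
    exact Complex.norm_exp_ofReal_mul_I _

/-- The monomial `∏_b z_b^{d_b}` at the torus point `z_b = e^{iθ_b}` is the character `e^{i⟨d,θ⟩}`. -/
theorem prod_cexp_mul_I_pow (θ : Fin N → ℝ) (d : Fin N →₀ ℕ) :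
    ∏ b, cexp (θ b * I) ^ (d b) = ∏ b, cexp ((d b : ℕ) * (θ b * I)) := by
  refine Finset.prod_congr rfl fun b _ => ?_
  rw [Complex.exp_nat_mul]

/-- **Parseval on the torus**: for an integer polynomial `P` in `N` variables,
`∫_{(−π,π]^N} |P(e^{iθ_1}, …, e^{iθ_N})|² dθ = (2π)^N Σ_d ([x^d] P)²`. -/
theorem integral_cube_norm_sq_eval₂ (P : MvPolynomial (Fin N) ℤ) :
    ∫ θ, ((‖MvPolynomial.eval₂ (Int.castRingHom ℂ) (fun b => cexp (θ b * I)) P‖ ^ 2 : ℝ) : ℂ)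
        ∂(Measure.pi fun _ : Fin N => (volume : Measure ℝ).restrict (Set.Ioc (-π) π))
      = (2 * π : ℂ) ^ N * ∑ d ∈ P.support, ((P.coeff d : ℤ) : ℂ) ^ 2 := by
  have hexp : ∀ θ : Fin N → ℝ,
      ((‖MvPolynomial.eval₂ (Int.castRingHom ℂ) (fun b => cexp (θ b * I)) P‖ ^ 2 : ℝ) : ℂ)
        = ∑ d ∈ P.support, ∑ e ∈ P.support, ((P.coeff d : ℤ) : ℂ) * ((P.coeff e : ℤ) : ℂ) *
            ∏ b, cexp ((((d b : ℕ) : ℤ) - ((e b : ℕ) : ℤ) : ℤ) * θ b * I) := by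
    intro θ
    rw [← Complex.normSq_eq_norm_sq, ← Complex.mul_conj, MvPolynomial.eval₂_eq']
    simp_rw [prod_cexp_mul_I_pow, eq_intCast]
    rw [map_sum, Finset.sum_mul_sum]
    refine Finset.sum_congr rfl fun d _ => Finset.sum_congr rfl fun e _ => ?_
    rw [map_mul, map_prod, map_intCast]
    have hconj : ∀ b, conj (cexp ((e b : ℕ) * (θ b * I))) = cexp (-((e b : ℕ) * (θ b * I))) := by
      intro b
      rw [← Complex.exp_conj, map_mul, map_natCast, map_mul, Complex.conj_ofReal, Complex.conj_I]
      ring_nf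
    simp_rw [hconj]
    rw [mul_mul_mul_comm, ← Finset.prod_mul_distrib]
    congr 1
    refine Finset.prod_congr rfl fun b _ => ?_
    rw [← Complex.exp_add]
    congr 1
    push_cast
    ring
  simp_rw [hexp]
  rw [integral_finsetSum _ (fun d _ => integrable_finsetSum _ fun e _ =>
    (integrable_cube_prod_cexp_int _).const_mul _)]
  simp_rw [integral_finsetSum _ (fun e _ => (integrable_cube_prod_cexp_int _).const_mul _),
    integral_const_mul]
  have hI : ∀ d e : Fin N →₀ ℕ,
      ∫ θ : Fin N → ℝ, ∏ b, cexp ((((d b : ℕ) : ℤ) - ((e b : ℕ) : ℤ) : ℤ) * θ b * I)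
        ∂(Measure.pi fun _ : Fin N => (volume : Measure ℝ).restrict (Set.Ioc (-π) π))
        = if d = e then (2 * π : ℂ) ^ N else 0 := by
    intro d e
    have h := integral_cube_prod_cexp (n := Fin N) (fun b => ((d b : ℕ) : ℤ) - ((e b : ℕ) : ℤ))
    simp only [Fintype.card_fin] at h
    rw [h]
    congr 1
    simp only [funext_iff, Pi.zero_apply, sub_eq_zero, Nat.cast_inj, eq_iff_iff]
    exact ⟨fun h' => Finsupp.ext h', fun h' b => by rw [h']⟩
  simp_rw [hI, mul_ite, mul_zero, Finset.sum_ite_eq, Finset.mul_sum]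
  refine Finset.sum_congr rfl fun d hd => ?_
  rw [if_pos hd]
  ring

/-- Parseval, real form. -/
theorem integral_cube_norm_sq_eval₂_real (P : MvPolynomial (Fin N) ℤ) :
    ∫ θ, ‖MvPolynomial.eval₂ (Int.castRingHom ℂ) (fun b => cexp (θ b * I)) P‖ ^ 2
        ∂(Measure.pi fun _ : Fin N => (volume : Measure ℝ).restrict (Set.Ioc (-π) π))
      = (2 * π) ^ N * ∑ d ∈ P.support, ((P.coeff d : ℤ) : ℝ) ^ 2 := by
  have h := integral_cube_norm_sq_eval₂ P
  rw [show (∫ θ, ((‖MvPolynomial.eval₂ (Int.castRingHom ℂ) (fun b => cexp (θ b * I)) P‖ ^ 2 : ℝ) : ℂ)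
      ∂(Measure.pi fun _ : Fin N => (volume : Measure ℝ).restrict (Set.Ioc (-π) π)))
      = ((∫ θ, ‖MvPolynomial.eval₂ (Int.castRingHom ℂ) (fun b => cexp (θ b * I)) P‖ ^ 2
      ∂(Measure.pi fun _ : Fin N => (volume : Measure ℝ).restrict (Set.Ioc (-π) π)) : ℝ) : ℂ) from
    integral_ofReal] at h
  exact_mod_cast h

/-! ### 2. The alternant `a_ρ · p_1^n` at the torus point -/

/-- The evaluation of `a_ρ(X) · p_1(X)^n` at `z_b = e^{iθ_b}` is `a_ρ(z) · (Σ_b z_b)^n`. -/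
theorem eval₂_alternant_mul_psum_pow (θ : Fin N → ℝ) (n : ℕ) :
    MvPolynomial.eval₂ (Int.castRingHom ℂ) (fun b => cexp (θ b * I))
        (alternant (fun i => (MvPolynomial.X i : MvPolynomial (Fin N) ℤ)) (rho N) *
          MvPolynomial.psum (Fin N) ℤ 1 ^ n)
      = alternant (fun b => cexp (θ b * I)) (rho N) * (∑ b, cexp (θ b * I)) ^ n := by
  rw [MvPolynomial.eval₂_mul, MvPolynomial.eval₂_pow, MvPolynomial.psum_one, MvPolynomial.eval₂_sum]
  congr 1
  · have h := map_alternant (MvPolynomial.eval₂Hom (Int.castRingHom ℂ) (fun b => cexp (θ b * I)))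
      (fun i => (MvPolynomial.X i : MvPolynomial (Fin N) ℤ)) (rho N)
    rw [MvPolynomial.coe_eval₂Hom] at h
    rw [h]
    congr 1
    funext i
    simp
  · congr 1
    exact Finset.sum_congr rfl fun b _ => MvPolynomial.eval₂_X _ _ _

/-- `|a_ρ(e^{iθ})| = |Δ(θ)|`: the staircase alternant at the torus point is the Vandermonde
product of the tree's Weyl-integration files up to a sign (a relabelling of the columns). -/
theorem norm_alternant_rho_eq_norm_vdm (θ : Fin N → ℝ) :
    ‖alternant (fun b => cexp (θ b * I)) (rho N)‖ = ‖vdm θ‖ := by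
  set e' : Fin N ≃ Fin N := (enum (Fin N)).trans (finCongr (Fintype.card_fin N)) with he'
  set π' : Perm (Fin N) := Fin.revPerm.trans e'.symm with hπ'
  have hcol : ∀ j : Fin N, rho N j = ((enum (Fin N) (π' j) : ℕ)) := by
    intro j
    have h1 : e' (π' j) = Fin.rev j := by simp [hπ']
    have h2 : ((e' (π' j) : ℕ)) = (enum (Fin N) (π' j) : ℕ) := by simp [he']
    rw [← h2, h1]
    rfl
  have hM : (Matrix.of fun i j : Fin N => cexp (θ i * I) ^ rho N j) = (powMat θ).submatrix id π' := by
    ext i j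
    simp only [Matrix.of_apply, Matrix.submatrix_apply, id_eq, powMat, hcol]
  rw [alternant, hM, Matrix.det_permute', vdm_eq_det, norm_mul]
  have hs : ‖((((Equiv.Perm.sign π' : ℤˣ) : ℤ) : ℂ))‖ = 1 := by
    rcases Int.units_eq_one_or (Equiv.Perm.sign π') with h | h <;> simp [h]
  rw [hs, one_mul]

/-- `|a_ρ(e^{iθ}) (Σ_b e^{iθ_b})^n|² = |Σ_b e^{iθ_b}|^{2n} · Π_{j≺k}|e^{iθ_j} − e^{iθ_k}|²`. -/
theorem norm_sq_eval₂_alternant_mul_psum_pow (θ : Fin N → ℝ) (n : ℕ) :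
    ‖MvPolynomial.eval₂ (Int.castRingHom ℂ) (fun b => cexp (θ b * I))
        (alternant (fun i => (MvPolynomial.X i : MvPolynomial (Fin N) ℤ)) (rho N) *
          MvPolynomial.psum (Fin N) ℤ 1 ^ n)‖ ^ 2
      = ‖∑ b, cexp (θ b * I)‖ ^ (2 * n) * ∏ p : OD (Fin N), ‖cexp (θ p.1.1 * I) - cexp (θ p.1.2 * I)‖ ^ 2 := by
  rw [eval₂_alternant_mul_psum_pow, norm_mul, norm_alternant_rho_eq_norm_vdm, norm_pow, mul_pow,
    ← pow_mul, prod_OD_norm_sub_sq_eq_norm_vdm_sq, mul_comm (2 : ℕ) n, mul_comm]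


end Summit.Ventures.LatticeQCDFlow.Scoring
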